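import Mathlib
import HarnessLib
import Summits.HubbardSuperconductivity.HubbardSuperconductivity.Theorems.WeakCouplingBCSWcbcsKohnLuttingerB1gFormAWindowD010D025
import Summits.HubbardSuperconductivity.HubbardSuperconductivity.Theorems.WeakCouplingBCSDefsKlCertB1gWinDRecord
import Summits.HubbardSuperconductivity.HubbardSuperconductivity.Theorems.WeakCouplingBCSKlCertFillingLowerD005

/-!
# Route `WeakCouplingBCS` — support item `WcbcsKohnLuttingerB1g` (stmt-HubbardSuperconductivity-0158):
# the R2d certificate half in FORM (A) on the FULL extended doping window `δ ∈ [0.05, 0.25]`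

With seat cert-2's second window record `klCertB1gWinD` (μ-uniform boxes on `μ ∈ [-0.1775, -0.075]`, margin
`γ_D = 17751 / 1048576`) the certified chemical-potential window of the `B1g` Kohn–Luttinger certificate is
`μ ∈ [-0.5725, -0.075] ⊇ [μ(0.25), μ(0.05)]`.  This file reads the FIVE window records — in form (A), i.e. modulo
`klCertB1gWin{Z,A,B,C}.EnclosuresB1g` and `klCertB1gWinD.EnclosuresB1g` — on the doping window `δ ∈ [0.05, 0.25]`:

* `muOfDoping_mem_window_d005_d025` — UNCONDITIONALLY `μ(δ) ∈ [-0.5725, -0.075]` for `δ ∈ [0.05, 0.25]`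
  (`klfillU025_filling_le : n(-0.5725) ≤ 3/4`, `klfillL005_filling_ge : n(-0.075) ≥ 19/20`,
  `chemicalPotentialOfDensity_window`);
* `klCertB1gWinD_b1g_le` (`decide +kernel`: every box has `B1g` Ritz `rhohi ≤ -1 / 4`; max `-0.2703`) and
  `klb1g_formA_b1g_le_window_d005_d010`;
* `klb1g_formA_r2d_certificate_d005_d025` — for every `δ ∈ [0.05, 0.25]`: (i) SELECTION for every `0 < U < 1`,
  `χ ≠ B1g`: `channelInf ε₀ μ(δ) U B1g + (16905 / 1048576) U² ≤ channelInf ε₀ μ(δ) U χ` (the smallest of the five record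
  margins); (ii) ATTRACTION for every `U`: `channelInf ε₀ μ(δ) U B1g ≤ -(1 / 12) U²`; and
  `klb1g_formA_klCoefficient_ge_d005_d025`.

Folklore glue; no definitions.
-/

noncomputable section

-- the tree's namespace `Summit.<Summit>.<Problem>.Theorems` repeats the summit name by design (D-0017)
set_option linter.dupNamespace false

namespace Summit.HubbardSuperconductivity.HubbardSuperconductivity.Theorems

open MeasureTheory Literature.MathematicalPhysics.QuantumLattice CwKLChiralWindow
open Summit.HubbardSuperconductivity.HubbardSuperconductivity.Theses.WeakCouplingBCS

/-- **`μ(δ) ∈ [-0.5725, -0.075]` for every hole doping `δ ∈ [0.05, 0.25]`** (unconditional; certified fillings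
`n(-0.5725) ≤ 3/4`, `n(-0.075) ≥ 19/20`, `chemicalPotentialOfDensity_window`). [folklore] -/
theorem muOfDoping_mem_window_d005_d025 :
    ∀ δ ∈ Set.Icc (0.05 : ℝ) 0.25,
      chemicalPotentialOfDensity (squareDispersion 1 0) (1 - δ) ∈ Set.Icc (-0.5725 : ℝ) (-0.075) := by
  obtain ⟨-, -, -, H⟩ := chemicalPotentialOfDensity_window (μ₁ := (-0.075 : ℝ)) (μ₂ := (-0.5725 : ℝ))
    (by norm_num) (by norm_num) (by norm_num)
  have hlo := klfillL005_filling_ge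
  have hhi := klfillU025_filling_le
  rw [show (-(3 / 40) : ℝ) = -0.075 by norm_num] at hlo
  rw [show (-(229 / 400) : ℝ) = -0.5725 by norm_num] at hhi
  intro δ hδ
  refine H δ ⟨?_, ?_⟩
  · norm_num at hδ hlo ⊢; linarith [hδ.1]
  · norm_num at hδ hhi ⊢; linarith [hδ.2]

/-- Every box of `klCertB1gWinD` has `B1g` Ritz upper bound `rhohi ≤ -1 / 4` (kernel decision). [folklore] -/
theorem klCertB1gWinD_b1g_le : (klCertB1gWinD.boxes.all fun bx => decide (bx.bB1g.rhohi ≤ -(1 / 4))) = true := by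
  decide +kernel

/-- **Certified attraction on `μ ∈ [-0.1775, -0.075]`** (the `WinD` window, `δ ≈ 0.05–0.10`), modulo its enclosures:
`channelInf ε₀ μ 1 B1g ≤ -1 / 4`. [cite: RaghuKivelsonScalapino2010, §III Fig. 2] -/
theorem klb1g_formA_b1g_le_window_d005_d010 (hD : klCertB1gWinD.EnclosuresB1g) :
    ∀ μ ∈ Set.Icc (-0.1775 : ℝ) (-0.075), channelInf (squareDispersion 1 0) μ 1 D4Irrep.B1g ≤ -(1 / 4 : ℝ) := by
  have wD := klb1gd_window_b1g_le klCertB1gWinD klCertB1gWinD_check hD (1 / 4) klCertB1gWinD_b1g_le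
  have e1 : (((klCertB1gWinD).mub : ℚ) : ℝ) = -0.1775 := by
    show (((-71 : ℚ) / 400 : ℚ) : ℝ) = -0.1775
    push_cast; norm_num
  have e2 : (((klCertB1gWinD).mua : ℚ) : ℝ) = -0.075 := by
    show (((-3 : ℚ) / 40 : ℚ) : ℝ) = -0.075
    push_cast; norm_num
  have ea : (((1 / 4 : ℚ) : ℚ) : ℝ) = (1 / 4 : ℝ) := by push_cast; norm_num
  rw [e1, e2, ea] at wD
  exact wD

/-- **R2d certificate half — form (A), δ-form on the full extended window `δ ∈ [0.05, 0.25]`.** Modulo the certified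
enclosures of the five window records: for every `δ ∈ [0.05, 0.25]`: (i) SELECTION — for every `0 < U < 1` and every
`χ ≠ B1g`, `channelInf ε₀ μ(δ) U B1g + (16905 / 1048576) U² ≤ channelInf ε₀ μ(δ) U χ`; (ii) ATTRACTION — for every real `U`,
`channelInf ε₀ μ(δ) U B1g ≤ -(1/12) U²`. [cite: RaghuKivelsonScalapino2010, §III Fig. 2] -/
theorem klb1g_formA_r2d_certificate_d005_d025 (hZ : klCertB1gWinZ.EnclosuresB1g) (hA : klCertB1gWinA.EnclosuresB1g)
    (hB : klCertB1gWinB.EnclosuresB1g) (hC : klCertB1gWinC.EnclosuresB1g) (hD : klCertB1gWinD.EnclosuresB1g) :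
    ∀ δ ∈ Set.Icc (0.05 : ℝ) 0.25,
      (∀ U ∈ Set.Ioo (0 : ℝ) 1, ∀ χ : D4Irrep, χ ≠ D4Irrep.B1g →
        channelInf (squareDispersion 1 0) (chemicalPotentialOfDensity (squareDispersion 1 0) (1 - δ)) U D4Irrep.B1g +
            (16905 / 1048576 : ℝ) * U ^ 2 ≤
          channelInf (squareDispersion 1 0) (chemicalPotentialOfDensity (squareDispersion 1 0) (1 - δ)) U χ) ∧
      (∀ U : ℝ, channelInf (squareDispersion 1 0) (chemicalPotentialOfDensity (squareDispersion 1 0) (1 - δ)) U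
          D4Irrep.B1g ≤ -(1 / 12 : ℝ) * U ^ 2) := by
  intro δ hδ
  have hμ := muOfDoping_mem_window_d005_d025 δ hδ
  set μ := chemicalPotentialOfDensity (squareDispersion 1 0) (1 - δ) with hμdef
  have hmo : μ ∈ Set.Ioo (-4 : ℝ) 0 := ⟨by linarith [hμ.1], by linarith [hμ.2]⟩
  -- the `WinD` window statement with explicit ends and its margin
  have wD := klCertB1gWinD_window_U hD
  have e1 : (((klCertB1gWinD).mub : ℚ) : ℝ) = -0.1775 := by
    show (((-71 : ℚ) / 400 : ℚ) : ℝ) = -0.1775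
    push_cast; norm_num
  have e2 : (((klCertB1gWinD).mua : ℚ) : ℝ) = -0.075 := by
    show (((-3 : ℚ) / 40 : ℚ) : ℝ) = -0.075
    push_cast; norm_num
  rw [e1, e2] at wD
  have hγD : (16905 / 1048576 : ℝ) ≤ ((klCertB1gWinD.gamma : ℚ) : ℝ) := by
    have hq : (16905 / 1048576 : ℚ) ≤ klCertB1gWinD.gamma := by decide +kernel
    have h' : ((16905 / 1048576 : ℚ) : ℝ) ≤ ((klCertB1gWinD.gamma : ℚ) : ℝ) := by exact_mod_cast hq
    push_cast at h'
    exact h'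
  refine ⟨fun U hU χ hχ => ?_, fun U => ?_⟩
  · by_cases hD' : μ ≤ -0.1775
    · -- inside [-0.5725, -0.1775]: the four-record statement of `…FormAWindowD010D025` at the μ level
      by_cases hcut : μ ≤ -0.42749
      · have wZ := klCertB1gWinZ_window_U hZ
        have z1 : (((klCertB1gWinZ).mub : ℚ) : ℝ) = -0.5725 := by
          show (((-229 : ℚ) / 400 : ℚ) : ℝ) = -0.5725
          push_cast; norm_num
        have z2 : (((klCertB1gWinZ).mua : ℚ) : ℝ) = -0.42749 := by
          show (((-42749 : ℚ) / 100000 : ℚ) : ℝ) = -0.42749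
          push_cast; norm_num
        rw [z1, z2] at wZ
        have hγZ : (16905 / 1048576 : ℝ) ≤ ((klCertB1gWinZ.gamma : ℚ) : ℝ) := by
          have hq : (16905 / 1048576 : ℚ) ≤ klCertB1gWinZ.gamma := by decide +kernel
          have h' : ((16905 / 1048576 : ℚ) : ℝ) ≤ ((klCertB1gWinZ.gamma : ℚ) : ℝ) := by exact_mod_cast hq
          push_cast at h'
          exact h'
        have h := wZ μ ⟨hμ.1, hcut⟩ U hU χ hχ
        nlinarith [sq_nonneg U]
      · have hγ : (16905 / 1048576 : ℝ) ≤ min (min ((klCertB1gWinA.gamma : ℚ) : ℝ) ((klCertB1gWinB.gamma : ℚ) : ℝ))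
            ((klCertB1gWinC.gamma : ℚ) : ℝ) := by
          have hq : (16905 / 1048576 : ℚ) ≤ klCertB1gWinA.gamma ∧ (16905 / 1048576 : ℚ) ≤ klCertB1gWinB.gamma ∧
              (16905 / 1048576 : ℚ) ≤ klCertB1gWinC.gamma := by
            refine ⟨?_, ?_, ?_⟩ <;> decide +kernel
          obtain ⟨h1, h2, h3⟩ := hq
          have h1' : ((16905 / 1048576 : ℚ) : ℝ) ≤ ((klCertB1gWinA.gamma : ℚ) : ℝ) := by exact_mod_cast h1
          have h2' : ((16905 / 1048576 : ℚ) : ℝ) ≤ ((klCertB1gWinB.gamma : ℚ) : ℝ) := by exact_mod_cast h2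
          have h3' : ((16905 / 1048576 : ℚ) : ℝ) ≤ ((klCertB1gWinC.gamma : ℚ) : ℝ) := by exact_mod_cast h3
          push_cast at h1' h2' h3'
          exact le_min (le_min h1' h2') h3'
        have h := klb1g_window_d010_d020 hA hB hC μ ⟨by linarith, hD'⟩ U hU χ hχ
        nlinarith [sq_nonneg U]
    · have h := wD μ ⟨by linarith, hμ.2⟩ U hU χ hχ
      nlinarith [sq_nonneg U]
  · have hfin : IsFiniteMeasure (fermiCurveMeasure (squareDispersion 1 0) μ) :=
      stub_klFiniteMeasure stub_klGradient stub_klHausdorffFinite μ hmo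
    have hinv := stub_klD4Invariant stub_klGradient μ hmo
    have hhom : channelInf (squareDispersion 1 0) μ U D4Irrep.B1g =
        U ^ 2 * channelInf (squareDispersion 1 0) μ 1 D4Irrep.B1g :=
      klhs_channelInf_sq stub_klKernelHS hmo U D4Irrep.B1g
        (fun ψ hψ => (stub_klMeanZero _ _ hfin hinv D4Irrep.B1g ψ (by decide) hψ).2)
    have h1 : channelInf (squareDispersion 1 0) μ 1 D4Irrep.B1g ≤ -(1 / 12 : ℝ) := by
      by_cases hD' : μ ≤ -0.1775
      · by_cases hcut : μ ≤ -0.42749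
        · exact klb1g_formA_b1g_le_window_d020_d025 hZ μ ⟨hμ.1, hcut⟩
        · have := klb1g_formA_b1g_le_window hA hB hC μ ⟨by linarith, hD'⟩
          linarith
      · have := klb1g_formA_b1g_le_window_d005_d010 hD μ ⟨by linarith, hμ.2⟩
        norm_num at this ⊢
        linarith
    rw [hhom]
    nlinarith [sq_nonneg U]

/-- **Positivity of the Kohn–Luttinger coefficient on the full extended window, form (A)**: for every
`δ ∈ [0.05, 0.25]`, `1/12 ≤ -channelInf ε₀ μ(δ) 1 B1g`. [cite: RaghuKivelsonScalapino2010, §III Fig. 2] -/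
theorem klb1g_formA_klCoefficient_ge_d005_d025 (hZ : klCertB1gWinZ.EnclosuresB1g) (hA : klCertB1gWinA.EnclosuresB1g)
    (hB : klCertB1gWinB.EnclosuresB1g) (hC : klCertB1gWinC.EnclosuresB1g) (hD : klCertB1gWinD.EnclosuresB1g) :
    ∀ δ ∈ Set.Icc (0.05 : ℝ) 0.25,
      (1 / 12 : ℝ) ≤ -channelInf (squareDispersion 1 0) (chemicalPotentialOfDensity (squareDispersion 1 0) (1 - δ)) 1
        D4Irrep.B1g := by
  intro δ hδ
  have h := (klb1g_formA_r2d_certificate_d005_d025 hZ hA hB hC hD δ hδ).2 1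
  norm_num at h ⊢
  linarith

end Summit.HubbardSuperconductivity.HubbardSuperconductivity.Theorems

end
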